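import Summits.CriticalPhenomena.PercolationContinuityZ3.Theorems.FK.PressureConvexity
import Mathlib.Analysis.Calculus.Deriv.Slope
import Mathlib.Analysis.SpecialFunctions.Log.Deriv
import HarnessLib

/-!
# FK-continuity cell, FO-10a: differentiability of the pressure in `q` forces `κ⁰ ≤ κ¹` — the `q`-direction
# tangent inequalities of the pressure and the slope sandwich (Grimmett 2006, Lemma (4.79) "⇒", (4.80)–(4.84))

Registered R89 (cell INBOX l.6394, 2026-08-24); registry row FO-10a-g338k; label KAP-B (coordinator fk-4 g195).
Cell `fk-continuity` (bschramm), row FO-10a; support file for the FK-continuity transplant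
(`--supports stmt-CriticalPhenomena-4575`); builds on p205010 (kernel theorem, internal audit signed;
external expert review pending). Pure proofs; no definitions, no named facts, no sorries; general `d`.

Grimmett's Lemma (4.79): for fixed `p`, the pressure is differentiable in `κ = log q` at `q` iff `φ⁰_{p,q} = φ¹_{p,q}`.
This file is the ANALYTIC half of the direction "⇒", kept abstract in the two cluster-count bounds so that it
does not wait for their (combinatorial) proofs:

* `le_of_differentiableAt_of_log_mul_le_sub` — real analysis: if `Φ` is differentiable at `q > 0`,
  `log(y/q)·κ₀ ≤ Φ(y) − Φ(q)` for `y ↓ q` and `log(y/q)·κ₁ ≤ Φ(y) − Φ(q)` for `y ↑ q`, then `κ₀ ≤ κ₁`;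
* `log_mul_le_pressure_sub_of_le` — the `q`-TANGENT INEQUALITY of the pressure from below at `q₁ ≤ q₂`: if the
  per-site box pressures with boundary condition `b` converge at `q₁` and `q₂` and the per-site mean cluster count
  at `q₁` is asymptotically `≥ κ`, then `log(q₂/q₁)·κ ≤ Φ₂ − Φ₁` (Jensen / `log_rcPartitionFunction_sub_ge₂` of
  `PressureConvexity.lean` with `p₁ = p₂`, divided by `|Λ_N|`, `N → ∞`);
* `log_mul_le_pressure_sub_of_ge` — the same read at `q₂ ≤ q₁` with an asymptotic UPPER bound `κ` on the per-site
  mean cluster count at `q₁`;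
* HEADLINE `le_of_differentiableAt_pressure_q` — if `|Λ_N|⁻¹ log Z^b_{Λ_N}(p,·) → Φ` near `q` for both `b`, the free
  per-site mean cluster count at `q` is asymptotically `≥ κ₀` and the wired one asymptotically `≤ κ₁`, then
  `DifferentiableAt ℝ Φ q → κ₀ ≤ κ₁`.

With `κ₀ = κ⁰(p,q) = φ⁰_{p,q}(|C|⁻¹)`, `κ₁ = κ¹(p,q)` (Grimmett (4.81)–(4.82): `k⁰(ω,Λ) ≥ Σ_{x∈Λ} |C_x|⁻¹` under
`φ⁰_Λ ≤_st φ⁰`, and the wired count bounded through the interior clusters under `φ¹ ≤_st φ¹_Λ` — to be supplied by the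
row's cluster-count file) and `κ¹ ≤ κ⁰` (`ClusterDensityCriterion.lean`), differentiability of `Φ(p,·)` at `q` gives
`κ⁰ = κ¹`, hence `φ⁰_{p,q} = φ¹_{p,q}` by Prop. (4.85) (`rcLimit_false_eq_rcLimit_true_iff_integral_inv_ncard_eq`).

## References
* G. Grimmett, *The Random-Cluster Model*, Springer 2006 (`book:grimmett2006-random-cluster-model`): §4.5,
  Thm. (4.58), Lemma (4.79), (4.80)–(4.84), Prop. (4.85) [PDF pp. 86, 93–95]. [Grimmett2006]
-/

noncomputable section

open Finset Filter Topology Set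

namespace Summit.CriticalPhenomena.PercolationContinuityZ3.Theorems.FK

open Literature.Probability.Percolation Literature.Probability.LatticeModels

/-! ### Real analysis: one-sided `log`-tangent bounds squeeze the derivative -/

section Slope

/-- **One-sided `log`-tangent bounds squeeze the derivative.** If `Φ` is differentiable at `q > 0`,
`log(y/q)·κ₀ ≤ Φ(y) − Φ(q)` for `y > q` near `q` and `log(y/q)·κ₁ ≤ Φ(y) − Φ(q)` for `y < q` near `q`,
then `κ₀ ≤ κ₁` (the derivative `D` satisfies `κ₀/q ≤ D ≤ κ₁/q`).
[cite: Grimmett2006, proof of Lemma (4.79), (4.80)–(4.84)] -/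
theorem le_of_differentiableAt_of_log_mul_le_sub {Φ : ℝ → ℝ} {q κ₀ κ₁ : ℝ} (hq : 0 < q)
    (hΦ : DifferentiableAt ℝ Φ q)
    (h₀ : ∀ᶠ y in 𝓝[>] q, Real.log (y / q) * κ₀ ≤ Φ y - Φ q)
    (h₁ : ∀ᶠ y in 𝓝[<] q, Real.log (y / q) * κ₁ ≤ Φ y - Φ q) : κ₀ ≤ κ₁ := by
  set D := deriv Φ q
  have hslope : Tendsto (slope Φ q) (𝓝[≠] q) (𝓝 D) := hasDerivAt_iff_tendsto_slope.1 hΦ.hasDerivAt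
  have hlog : Tendsto (slope Real.log q) (𝓝[≠] q) (𝓝 q⁻¹) :=
    hasDerivAt_iff_tendsto_slope.1 (Real.hasDerivAt_log hq.ne')
  have hlogslope : ∀ {y : ℝ}, 0 < y → y ≠ q → Real.log (y / q) = slope Real.log q y * (y - q) := by
    intro y hy hyq
    rw [slope_def_field, Real.log_div hy.ne' hq.ne', div_mul_cancel₀ _ (sub_ne_zero.2 hyq)]
  have hR : q⁻¹ * κ₀ ≤ D := by
    have h1 : Tendsto (fun y => slope Real.log q y * κ₀) (𝓝[>] q) (𝓝 (q⁻¹ * κ₀)) :=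
      (hlog.mono_left (nhdsGT_le_nhdsNE q)).mul_const κ₀
    have h2 : Tendsto (slope Φ q) (𝓝[>] q) (𝓝 D) := hslope.mono_left (nhdsGT_le_nhdsNE q)
    refine le_of_tendsto_of_tendsto h1 h2 ?_
    filter_upwards [h₀, eventually_mem_nhdsWithin] with y hy hyq
    have hyq' : q < y := hyq
    have hy0 : 0 < y := hq.trans hyq'
    rw [hlogslope hy0 hyq'.ne'] at hy
    rw [slope_def_field Φ q y, le_div_iff₀ (sub_pos.2 hyq')]
    linarith
  have hL : D ≤ q⁻¹ * κ₁ := by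
    have h1 : Tendsto (fun y => slope Real.log q y * κ₁) (𝓝[<] q) (𝓝 (q⁻¹ * κ₁)) :=
      (hlog.mono_left (nhdsLT_le_nhdsNE q)).mul_const κ₁
    have h2 : Tendsto (slope Φ q) (𝓝[<] q) (𝓝 D) := hslope.mono_left (nhdsLT_le_nhdsNE q)
    refine le_of_tendsto_of_tendsto h2 h1 ?_
    have hpos : ∀ᶠ y in 𝓝[<] q, 0 < y := (eventually_gt_nhds hq).filter_mono nhdsWithin_le_nhds
    filter_upwards [h₁, eventually_mem_nhdsWithin, hpos] with y hy hyq hy0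
    have hyq' : y < q := hyq
    rw [hlogslope hy0 hyq'.ne] at hy
    rw [slope_def_field Φ q y, div_le_iff_of_neg (sub_neg.2 hyq')]
    linarith
  exact le_of_mul_le_mul_left (hR.trans hL) (inv_pos.2 hq)

end Slope

/-! ### The `q`-tangent inequalities of the pressure -/

section Tangent

variable {d : ℕ} {p : ℝ}

/-- Per box: `log(q₂/q₁) · E^b_{Λ_N,p,q₁}[k] ≤ log Z^b_{Λ_N}(p,q₂) − log Z^b_{Λ_N}(p,q₁)` (Jensen; the `p`-terms of
`log_rcPartitionFunction_sub_ge₂` vanish at `p₁ = p₂`). [cite: Grimmett2006, proof of Thm. (4.58), (4.80)–(4.82)] -/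
theorem log_mul_rcExpect_clusterCount_le (hp : p ∈ Set.Ioo (0 : ℝ) 1) {q₁ q₂ : ℝ} (hq₁ : 0 < q₁) (hq₂ : 0 < q₂)
    (b : Bool) (N : ℕ) :
    Real.log (q₂ / q₁) * rcExpect (finsetGraph (zdGraph d) (box d N)) p q₁ (boxBC d b N)
        (fun ω => (clusterCount (↑ω : BondConfig ↥(box d N)) (boxBC d b N) : ℝ)) ≤
      Real.log (rcPartitionFunction (finsetGraph (zdGraph d) (box d N)) p q₂ (boxBC d b N)) -
        Real.log (rcPartitionFunction (finsetGraph (zdGraph d) (box d N)) p q₁ (boxBC d b N)) := by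
  have h := log_rcPartitionFunction_sub_ge₂ (finsetGraph (zdGraph d) (box d N)) hp hp hq₁ hq₂ (boxBC d b N)
  have h1 : Real.log (p / p) = 0 := by rw [div_self hp.1.ne', Real.log_one]
  have h2 : Real.log ((1 - p) / (1 - p)) = 0 := by rw [div_self (sub_pos.2 hp.2).ne', Real.log_one]
  rw [h1, h2, zero_mul, zero_mul, zero_add, zero_add] at h
  exact h

/-- **The `q`-tangent inequality from below at `q₁ ≤ q₂`**: if the per-site box pressures (b.c. `b`) converge at `q₁`
and at `q₂` and the per-site mean number of clusters at `q₁` is asymptotically `≥ κ`, then `log(q₂/q₁)·κ ≤ Φ₂ − Φ₁`.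
[cite: Grimmett2006, proof of Thm. (4.58) and Lemma (4.79), (4.80)–(4.82)] -/
theorem log_mul_le_pressure_sub_of_le (hp : p ∈ Set.Ioo (0 : ℝ) 1) {q₁ q₂ : ℝ} (hq₁ : 0 < q₁) (h12 : q₁ ≤ q₂)
    {b : Bool} {Φ₁ Φ₂ κ : ℝ}
    (hΦ₁ : Tendsto (fun N : ℕ =>
      Real.log (rcPartitionFunction (finsetGraph (zdGraph d) (box d N)) p q₁ (boxBC d b N)) / #(box d N)) atTop (𝓝 Φ₁))
    (hΦ₂ : Tendsto (fun N : ℕ =>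
      Real.log (rcPartitionFunction (finsetGraph (zdGraph d) (box d N)) p q₂ (boxBC d b N)) / #(box d N)) atTop (𝓝 Φ₂))
    (hK : ∀ δ : ℝ, 0 < δ → ∀ᶠ N : ℕ in atTop, κ - δ ≤ rcExpect (finsetGraph (zdGraph d) (box d N)) p q₁ (boxBC d b N)
      (fun ω => (clusterCount (↑ω : BondConfig ↥(box d N)) (boxBC d b N) : ℝ)) / #(box d N)) :
    Real.log (q₂ / q₁) * κ ≤ Φ₂ - Φ₁ := by
  have hq₂ : 0 < q₂ := hq₁.trans_le h12
  have hlog : 0 ≤ Real.log (q₂ / q₁) := Real.log_nonneg ((one_le_div hq₁).2 h12)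
  have hlim : Tendsto (fun N : ℕ =>
      (Real.log (rcPartitionFunction (finsetGraph (zdGraph d) (box d N)) p q₂ (boxBC d b N)) -
        Real.log (rcPartitionFunction (finsetGraph (zdGraph d) (box d N)) p q₁ (boxBC d b N))) / #(box d N)) atTop
      (𝓝 (Φ₂ - Φ₁)) := by
    refine (hΦ₂.sub hΦ₁).congr fun N => ?_
    rw [sub_div]
  -- for every δ > 0: log(q₂/q₁) (κ − δ) ≤ Φ₂ − Φ₁
  have hall : ∀ δ : ℝ, 0 < δ → Real.log (q₂ / q₁) * (κ - δ) ≤ Φ₂ - Φ₁ := by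
    intro δ hδ
    refine le_of_tendsto_of_tendsto tendsto_const_nhds hlim ?_
    filter_upwards [hK δ hδ] with N hN
    have hpos : (0 : ℝ) < #(box d N) := by exact_mod_cast Finset.card_pos.2 (box_nonempty d N)
    calc Real.log (q₂ / q₁) * (κ - δ)
        ≤ Real.log (q₂ / q₁) * (rcExpect (finsetGraph (zdGraph d) (box d N)) p q₁ (boxBC d b N)
            (fun ω => (clusterCount (↑ω : BondConfig ↥(box d N)) (boxBC d b N) : ℝ)) / #(box d N)) :=
          mul_le_mul_of_nonneg_left hN hlog
      _ = (Real.log (q₂ / q₁) * rcExpect (finsetGraph (zdGraph d) (box d N)) p q₁ (boxBC d b N)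
            (fun ω => (clusterCount (↑ω : BondConfig ↥(box d N)) (boxBC d b N) : ℝ))) / #(box d N) := by
          rw [mul_div_assoc]
      _ ≤ _ := div_le_div_of_nonneg_right (log_mul_rcExpect_clusterCount_le hp hq₁ hq₂ b N) hpos.le
  -- let δ ↓ 0
  have hcont : Tendsto (fun δ : ℝ => Real.log (q₂ / q₁) * (κ - δ)) (𝓝[>] 0) (𝓝 (Real.log (q₂ / q₁) * κ)) := by
    have h : Tendsto (fun δ : ℝ => Real.log (q₂ / q₁) * (κ - δ)) (𝓝 0) (𝓝 (Real.log (q₂ / q₁) * (κ - 0))) :=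
      ((tendsto_const_nhds.sub tendsto_id).const_mul _)
    rw [sub_zero] at h
    exact h.mono_left nhdsWithin_le_nhds
  exact le_of_tendsto hcont (eventually_mem_nhdsWithin.mono fun δ hδ => hall δ hδ)

/-- **The `q`-tangent inequality from below at `q₂ ≤ q₁`**: if the per-site box pressures (b.c. `b`) converge at `q₁`
and at `q₂` (`0 < q₂ ≤ q₁`) and the per-site mean number of clusters at `q₁` is asymptotically `≤ κ`, then again
`log(q₂/q₁)·κ ≤ Φ₂ − Φ₁` (now `log(q₂/q₁) ≤ 0`). [cite: Grimmett2006, proof of Thm. (4.58) and Lemma (4.79), (4.80)–(4.82)] -/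
theorem log_mul_le_pressure_sub_of_ge (hp : p ∈ Set.Ioo (0 : ℝ) 1) {q₁ q₂ : ℝ} (hq₂ : 0 < q₂) (h21 : q₂ ≤ q₁)
    {b : Bool} {Φ₁ Φ₂ κ : ℝ}
    (hΦ₁ : Tendsto (fun N : ℕ =>
      Real.log (rcPartitionFunction (finsetGraph (zdGraph d) (box d N)) p q₁ (boxBC d b N)) / #(box d N)) atTop (𝓝 Φ₁))
    (hΦ₂ : Tendsto (fun N : ℕ =>
      Real.log (rcPartitionFunction (finsetGraph (zdGraph d) (box d N)) p q₂ (boxBC d b N)) / #(box d N)) atTop (𝓝 Φ₂))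
    (hK : ∀ δ : ℝ, 0 < δ → ∀ᶠ N : ℕ in atTop, rcExpect (finsetGraph (zdGraph d) (box d N)) p q₁ (boxBC d b N)
      (fun ω => (clusterCount (↑ω : BondConfig ↥(box d N)) (boxBC d b N) : ℝ)) / #(box d N) ≤ κ + δ) :
    Real.log (q₂ / q₁) * κ ≤ Φ₂ - Φ₁ := by
  have hq₁ : 0 < q₁ := hq₂.trans_le h21
  have hlog : Real.log (q₂ / q₁) ≤ 0 := Real.log_nonpos (div_pos hq₂ hq₁).le ((div_le_one hq₁).2 h21)
  have hlim : Tendsto (fun N : ℕ =>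
      (Real.log (rcPartitionFunction (finsetGraph (zdGraph d) (box d N)) p q₂ (boxBC d b N)) -
        Real.log (rcPartitionFunction (finsetGraph (zdGraph d) (box d N)) p q₁ (boxBC d b N))) / #(box d N)) atTop
      (𝓝 (Φ₂ - Φ₁)) := by
    refine (hΦ₂.sub hΦ₁).congr fun N => ?_
    rw [sub_div]
  -- for every δ > 0: log(q₂/q₁) (κ + δ) ≤ Φ₂ − Φ₁
  have hall : ∀ δ : ℝ, 0 < δ → Real.log (q₂ / q₁) * (κ + δ) ≤ Φ₂ - Φ₁ := by
    intro δ hδ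
    refine le_of_tendsto_of_tendsto tendsto_const_nhds hlim ?_
    filter_upwards [hK δ hδ] with N hN
    have hpos : (0 : ℝ) < #(box d N) := by exact_mod_cast Finset.card_pos.2 (box_nonempty d N)
    calc Real.log (q₂ / q₁) * (κ + δ)
        ≤ Real.log (q₂ / q₁) * (rcExpect (finsetGraph (zdGraph d) (box d N)) p q₁ (boxBC d b N)
            (fun ω => (clusterCount (↑ω : BondConfig ↥(box d N)) (boxBC d b N) : ℝ)) / #(box d N)) :=
          mul_le_mul_of_nonpos_left hN hlog
      _ = (Real.log (q₂ / q₁) * rcExpect (finsetGraph (zdGraph d) (box d N)) p q₁ (boxBC d b N)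
            (fun ω => (clusterCount (↑ω : BondConfig ↥(box d N)) (boxBC d b N) : ℝ))) / #(box d N) := by
          rw [mul_div_assoc]
      _ ≤ _ := div_le_div_of_nonneg_right (log_mul_rcExpect_clusterCount_le hp hq₁ hq₂ b N) hpos.le
  -- let δ ↓ 0
  have hcont : Tendsto (fun δ : ℝ => Real.log (q₂ / q₁) * (κ + δ)) (𝓝[>] 0) (𝓝 (Real.log (q₂ / q₁) * κ)) := by
    have h : Tendsto (fun δ : ℝ => Real.log (q₂ / q₁) * (κ + δ)) (𝓝 0) (𝓝 (Real.log (q₂ / q₁) * (κ + 0))) :=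
      ((tendsto_const_nhds.add tendsto_id).const_mul _)
    rw [add_zero] at h
    exact h.mono_left nhdsWithin_le_nhds
  exact le_of_tendsto hcont (eventually_mem_nhdsWithin.mono fun δ hδ => hall δ hδ)

end Tangent

/-! ### The criterion -/

section Criterion

variable {d : ℕ} {p : ℝ}

/-- **Differentiability of the pressure in `q` forces `κ₀ ≤ κ₁`** (Grimmett 2006, Lemma (4.79) "⇒" modulo the two
cluster-count bounds (4.81)–(4.82)): if the per-site box pressures converge to `Φ` near `q` for both boundary conditions,
the per-site mean number of clusters at `q` is asymptotically `≥ κ₀` for one boundary condition `b₀` and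
asymptotically `≤ κ₁` for another `b₁` (Grimmett: `b₀` = free with `κ₀ = κ⁰`, `b₁` = wired with `κ₁ = κ¹`), and `Φ` is
differentiable at `q`, then `κ₀ ≤ κ₁`. (With `κ₀ = κ⁰(p,q) ≥ κ¹(p,q) = κ₁` this is `κ⁰ = κ¹`, whence
`φ⁰_{p,q} = φ¹_{p,q}` by Prop. (4.85).) [cite: Grimmett2006, Lemma (4.79), (4.80)–(4.84), Prop. (4.85)] -/
theorem le_of_differentiableAt_pressure_q (hp : p ∈ Set.Ioo (0 : ℝ) 1) {q : ℝ} (hq : 0 < q) {Φ : ℝ → ℝ} {κ₀ κ₁ : ℝ}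
    {b₀ b₁ : Bool}
    (hΦ : ∀ b : Bool, ∀ᶠ y in 𝓝 q, Tendsto (fun N : ℕ =>
      Real.log (rcPartitionFunction (finsetGraph (zdGraph d) (box d N)) p y (boxBC d b N)) / #(box d N)) atTop (𝓝 (Φ y)))
    (h₀ : ∀ δ : ℝ, 0 < δ → ∀ᶠ N : ℕ in atTop, κ₀ - δ ≤ rcExpect (finsetGraph (zdGraph d) (box d N)) p q (boxBC d b₀ N)
      (fun ω => (clusterCount (↑ω : BondConfig ↥(box d N)) (boxBC d b₀ N) : ℝ)) / #(box d N))
    (h₁ : ∀ δ : ℝ, 0 < δ → ∀ᶠ N : ℕ in atTop, rcExpect (finsetGraph (zdGraph d) (box d N)) p q (boxBC d b₁ N)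
      (fun ω => (clusterCount (↑ω : BondConfig ↥(box d N)) (boxBC d b₁ N) : ℝ)) / #(box d N) ≤ κ₁ + δ)
    (hdiff : DifferentiableAt ℝ Φ q) : κ₀ ≤ κ₁ := by
  have hq0 : Tendsto (fun N : ℕ =>
      Real.log (rcPartitionFunction (finsetGraph (zdGraph d) (box d N)) p q (boxBC d b₀ N)) / #(box d N)) atTop
      (𝓝 (Φ q)) := (hΦ b₀).self_of_nhds
  have hq1 : Tendsto (fun N : ℕ =>
      Real.log (rcPartitionFunction (finsetGraph (zdGraph d) (box d N)) p q (boxBC d b₁ N)) / #(box d N)) atTop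
      (𝓝 (Φ q)) := (hΦ b₁).self_of_nhds
  refine le_of_differentiableAt_of_log_mul_le_sub hq hdiff ?_ ?_
  · filter_upwards [nhdsWithin_le_nhds (hΦ b₀), eventually_mem_nhdsWithin] with y hy hyq
    exact log_mul_le_pressure_sub_of_le hp hq (le_of_lt hyq) hq0 hy h₀
  · have hpos : ∀ᶠ y in 𝓝[<] q, 0 < y := (eventually_gt_nhds hq).filter_mono nhdsWithin_le_nhds
    filter_upwards [nhdsWithin_le_nhds (hΦ b₁), eventually_mem_nhdsWithin, hpos] with y hy hyq hy0
    exact log_mul_le_pressure_sub_of_ge hp hy0 (le_of_lt hyq) hq1 hy h₁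

end Criterion

end Summit.CriticalPhenomena.PercolationContinuityZ3.Theorems.FK

end
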